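import Mathlib
import HarnessLib
import HarnessLib.Audit
import Summits.PneNP.Statement
import Literature.Computability.Complexity.Promise
import Literature.Computability.Complexity.PolyHierarchy
import Literature.Computability.MetaComplexity.HeuristicClasses
import Summits.PneNP.PneNP.Theorems.SzkEntropyPhCollapseStandalone
import Summits.PneNP.PneNP.Theorems.SzkEntropyCookModelBridgeStandalone
import Summits.PneNP.PneNP.Theorems.SzkEntropyAssemblyStandalone
import Summits.PneNP.PneNP.Theorems.SzkEntropyPeaMemPH
import HarnessLib.Audit.Status.Attr
-- import Summits.PneNP.PneNP.Theorems.SzkEntropyPeaDegreeReduction dropped: it (transitively) imports this route file — proofs used by `closes`/`_holds` must live in a module that does not import the Theses file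

/-!
Route: SzkEntropy

DORMANT since 2026-08-22T09:23:40Z (reconciler: no traction for 5.2 d (last activity item-evidence-added at 2026-08-17T03:05:40Z); parked, not closed — `ledger route dormant route-PneNP-SzkEntropy --off` to reactivate) — unstaffed, not closed; items shared with open routes are served there. `ledger route dormant <id> --off` reactivates.

Thesis X (it suffices to show): POLYNOMIAL ENTROPY APPROXIMATION FOR CUBIC MAPS OVER F_2 IS NOT IN
PROMISE-P (card PneNP/PneNP/szk-entropy-cubic-maps).
PEA_3: given a polynomial map p = (p_1,…,p_m) : F_2^n → F_2^m with every p_i of degree ≤ 3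
(sparsely, as lists of monomials = lists of variable indices) and k ∈ ℕ, decide whether the Shannon
entropy H(p(U_n)) of the output on a uniform input is ≥ k+1 (yes) or ≤ k (no).
Lean (one line, over Mathlib + Literature.Computability.Complexity.Promise only; spelled inline `let
ev := …; let H := …; let PEA := …; PEA 3 ∉ PromiseP` in every item, see decl PeaThreeNotInP;
DEFINITIONALLY EQUAL (Iff.rfl, checked at rev 2 in the planner's SketchDefeq.lean) both to the rev ≤
1 spelling via Literature.Computability.Cryptography.mapEntropy and to
`Literature.Computability.Complexity.PEA 3 ∉ Literature.Computability.Complexity.PromiseP` of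
Literature/Computability/Complexity/PolynomialEntropyApproximation.lean — not imported yet because
that file still imports the cryptography cone): ev n p x := p.map fun q => (q.map fun μ => (μ.map
x).prod).sum (value of the sparse map at x ∈ F_2^n); H I := (∑ x : Fin I.1 → ZMod 2, Real.logb 2
(|F_2^n| / #{x' | ev n p x' = ev n p x})) / |F_2^n| with |F_2^n| := (Finset.univ : Finset (Fin I.1 →
ZMod 2)).card (Shannon entropy of p(U_n) in bits); PEA d :=
Literature.Computability.Complexity.PromiseProblem.ofEncoding (Computability.Encoding.sigmaBool fun
n => ((Literature.Computability.Complexity.encodingFinBool n).listBool.listBool.listBool).pairBool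
Computability.encodingNatBool) {I : (Σ n, List (List (List (Fin n))) × ℕ) | (∀ q ∈ I.2.1, ∀ μ ∈ q,
μ.length ≤ d) ∧ (I.2.2:ℝ) + 1 ≤ H I} {I | (deg ≤ d) ∧ H I ≤ I.2.2};  X := PEA 3 ∉
Literature.Computability.Complexity.PromiseP.
Meaning: by Dvir–Gutfreund–Rothblum–Vadhan [DvirGutfreundRothblumVadhan2010, Thm 1.1 = Thm 4.7 + §3
p.6: PEA and the SZKP_L-complete PED_{F_2,3} are equivalent under ≤2-query truth-table reductions;
direct products turn any additive-constant gap into gap 1 at integer thresholds] X ⟺ SZKP_L ⊄ prP,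
where SZKP_L = statistical zero knowledge with log-space verifier AND simulator (two-way access to
input, coins, transcript) ∋ Graph Isomorphism, Quadratic Residuosity, DDH/DLOG, GapCVP_{√n}; and
entropy approximation of 4-local maps is NISZK_L-complete even with k = m − 3
[AllenderGouwarHiraharaRobelle2023; AllenderGrayMutrejaTirumalaWang2025, Thm 7]. X ⟹ PneNP by a
three-line collapse, which is now the route's CERTIFIED deciding theorem `closes (hX :
PeaThreeNotInP) (hPH : PeaMemPH) (hC : PhCollapse) (hB : CookModelBridge) : PneNP` (5 tactic lines,
axioms propext/choice/Quot.sound): if ¬PneNP then NP ⊆ P in Cook's Clay model, hence — by the model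
bridge CookModelBridge (= the proved tree facts P_bool_eq_holds ∧ NP_bool_eq_holds, filed as a
support item so that the route file imports no ClayProblem/cryptography module) —
Nondeterministic.NP ⊆ Classes.P, hence PH ⊆ P (support PhCollapse), hence promiseLift PH ⊆
promiseLift P = PromiseP (promiseLift_mono), and PEA_3 ∈ promiseLift PH (support PeaMemPH:
Stockmeyer fibre counting with an NP oracle + sampling + Lautemann, provable over PROVED tree facts)
lands in PromiseP, contradicting X.
The one idea (dictionary): by Parseval the collision entropy of p(U_n) is a CENSUS of biased members
of the linear system spanned by the outputs, 2^{-H_2(p(U_n))} = 2^{-m} Σ_{λ∈F_2^m} bias(λ·p)^2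
[DvirGutfreundRothblumVadhan2010, Claim 5.6], and for cubics bias is governed by partition rank (=
slice rank for 3-tensors, `Literature.Combinatorics.Additive.HasSliceRankLE`) [KaufmanLovett2008;
HaramatyShpilka2010; Milicevic2019; CohenMoshkovitz2023]: "approximate the entropy" = "approximately
count the low-rank cubics hidden in an m-dimensional linear system of cubics", in the
approximate-counting regime where NP-hardness is provably unavailable (PEA_3 ∈ AM ∩ coAM).

UNDER FLOOR: fewer than 2 cruxes remain after retriage (legacy route; D-0019).

Rationale: WHY THIS LINE. (widen: higher-order Fourier analysis over F_2 + statistical zero knowledge). X =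
"PEA_3 ∉ prP" ⟺ SZKP_L ⊄ prP [DvirGutfreundRothblumVadhan2010 Thm 1.1/4.7] is the WEAKEST structured
hardness thesis near P ≠ NP that still yields it by a 3-line collapse: it is implied by route
Lattice's thesis (GapSVP_n ≤ GapCVP_{√n} ∈ SZKP_L), by QR/DDH/DLOG/GI ∉ BPP, and is incomparable
with OWF (no black-box SZK-hardness from OWF [BitanskyDegwekarVaikuntanathan2021]). Its complete
problem is ALGEBRAIC and low-degree (every log-space sampler has a perfect degree-3 randomized
encoding [ApplebaumIshaiKushilevitz2006]; 4-local entropy approximation is NISZK_L-complete even at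
deficiency k = m−3 [AllenderGouwarHiraharaRobelle2023; AllenderGrayMutrejaTirumalaWang2025 Thm 7]),
so the whole class is compiled into ONE question about cubic maps over F_2 where a quantitative bias
⟺ rank theory exists and is moving (2008–2023). NP-hardness cannot be the source of hardness (AM ∩
coAM), which forces and licenses a direct structural theory of instances; unlike GapSVP the
instances carry a group action GL_n(F_2) × GL_m(F_2) × direct products and an equidistribution
theory — the two ingredients random self-reductions are made of. DGRV (pp.2–3, read) state exactly
this programme (worst-case/average-case for SZKP_L via PEA; algebraic characterisations of entropy
over small fields) as open. Catalogue used: duality/Fourier side (entropy ↔ Walsh spectrum ↔ rank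
census), probabilistic method (equidistribution of high-rank systems), a field-size DIAL: over F_q,
q odd, homogeneous quadratics are solved by ranks of random directional derivatives [DGRV Thm 5.3,
Lemma 5.2]; at q = 2 the Frobenius x ↦ x^2 is linear, D_a(x_i^2) is constant, and Lemma 5.2 fails —
the difficulty is localised in inseparability (degree 2, q = 2) and in degree 3 (any q). Degree
dial: d = 1 is matrix rank (DGRV p.1), d = 3 is all of SZKP_L (support PeaDegreeReduction), d = 2
over F_2 is open both ways (support PeaTwoMemBPP, negative side). WHY THIS FORM (X) RATHER THAN P ≠
NP DIRECTLY — the honest account for the reduction axis: X is STRONGER than the summit (X ⟹ PneNP by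
`closes`; the converse is not expected), so nothing is gained in logical strength. What is gained is
STRUCTURE and FALSIFIABILITY: one explicit algebraic instance class (sparse cubic maps over F_2)
with a GL_n(F_2) × GL_m(F_2) × direct-product action and a quantitative bias ⟺ partition-rank theory
[KaufmanLovett2008; Milicevic2019; CohenMoshkovitz2023]; NP-hardness provably NOT the source (prAM ∩
pr-coAM); a degree/field dial with an algorithmic negative side (PeaTwoMemBPP, PeaThreeMemBPP) and a
consequence side (PeaWorstToAvg) that make the NEIGHBOURHOOD of X decidable piece by piece. What is
NOT gained, and not claimed: a lower-bound technique — no method in print proves any explicit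
promise problem of PH outside prP; the attack on X itself is empty (NOT DECOMPOSED YET), which is
why this route is, in substance, a conditional bridge.
RANKED CRUXES. ONE crux — the thesis itself: #0 PeaThreeNotInP = X (auto-crux since the 2026-08-16
backfill: the one hypothesis of the deciding theorem `closes` that nothing in the route derives; a
bare hardness claim of lower-bound strength, ⟺ SZKP_L ⊄ prP; why it might fail: false as soon as
SZKP_L ⊆ prP — GI is already quasi-polynomial [arXiv:1512.03547], QR/DLOG/GapCVP_√n would all have
to be easy). The other three hypotheses of `closes` (PeaMemPH, PhCollapse, CookModelBridge) are
PROVED supports, so `closes` fires exactly when X is proved. JUDGE REPAIR (D-0031 pass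
2026-08-16T06:45Z: tier C, "attractive side mathematics … all machine-unused"; what_would_move_it =
"PeaWorstToAvg proved and wired so that a restricted-model average-case bound feeds X") — examined
at rev 7 and NOT REALISABLE, by a tree theorem rather than by taste:
`Summit.PneNP.PneNP.Theorems.szkEntropy_peaWorstToAvg_or_peaThreeNotInP : PeaWorstToAvg ∨
PeaThreeNotInP` is LANDED (Theorems/PeaWorstToAvg/Negative/NotPeaWorstToAvgImpliesTarget.lean,
sorry-free; ¬PeaWorstToAvg unfolds to "PEA_3 ∉ prBPP' ∧ every on-promise samplable ensemble is
HeurBPP-easy", whose first conjunct gives X through PromiseP ⊆ PromiseBPP'). Hence for ANY candidate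
deciding theorem `closes' (hW : PeaWorstToAvg) (Γ) : PneNP` over this route's items, Γ ⊢ PneNP
already (cases on the disjunction; the X branch is the present `closes` with its three proved
supports): PeaWorstToAvg is ELIMINABLE from every deciding theorem of this route, i.e. it can be
"wired" only vacuously — the ¬(A → B) ⊢ A costume (rev 4 note) or a detour X' → AvgHard → … → PneNP
in which hX' alone suffices. The same holds for every statement S with ¬PneNP ⊢ S, in particular for
every "hardness ⟹ more hardness" transfer whose antecedent P = NP refutes (worst-case →
average-case, SZK-hardness → OWF [Ostrovsky1991], → PRG): on the summit P ≠ NP such statements are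
CONSEQUENCE-side instrumentation, never cruxes of a deciding chain. Therefore PeaWorstToAvg STAYS
SUPPORT (rev-5 decision confirmed; re-kinding it crux would only restore, permanently, the
glue.unused-crux flag the judge penalised, since no edit of `closes` can consume it) and is NOT
dropped (as support it keeps its landed lemmas and its crux chain connected). Its honest role in
THIS route is kill-side infrastructure (KILL CRITERIA). For the operator / a judge re-read: its
chain (Cruxes/PeaWorstToAvg — lines dual-mode-compile, orbit-pair-rsr, dti-errorless-core,
lattice-import-trapdoor-support; Disproof.lean v5; 11 Negative lemmas; ~40 landed
Theorems/SzkEntropyPeaWorstToAvg*.lean supports) attacks DGRV's printed open problem — average-case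
hardness of SZKP_L from worst-case hardness, hence with [Ostrovsky1991] one-way functions from SZK_L
⊄ BPP, where only auxiliary-input OWF is known [OstrovskyWigderson1993] — valuable mathematics that
cannot move P ≠ NP by the disjunction above; staffing it is a portfolio decision (judge pin /
operator), not a wiring one, and tier C is the honest tier of a conditional bridge on SZKP_L ⊄ prP.
PeaTwoMemBPP (PEA_2 over F_2 ∈ prBPP') is likewise support since rev 4: its proof pivots the line,
its refutation proves X outright — LANDED as szkEntropy_not_peaTwoMemBPP_imp_peaThreeNotInP
(Theorems/PeaTwoMemBPP/Negative/NotPeaTwoMemBPPImpliesTarget.lean: PromiseP ⊆ PromiseBPP' + degree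
monotonicity) — rung 1 of the kill ladder under PeaThreeMemBPP. UNDER FLOOR (1 crux < 2) stands and
is honest: every sufficient condition for X found so far is a bare hardness claim at least as strong
(GI / QR / DLOG / GapCVP_√n ∉ prP, PEA_2 ∉ prP, PEA_3 ∉ prBPP'), and every conjunction "B ∧ (B → X)"
with B provable (e.g. a restricted-model average-case bound) hides X in its second conjunct (NOT
DECOMPOSED YET); the route is the conditional bridge PneNP ⇐ X with the condition promoted to crux —
the normal form the gate gives bridges — and should be read and staffed as such.
SUPPORT (unranked): PeaMemPH (∀ d, PEA_d ∈ promiseLift PH: Stockmeyer NP-oracle fibre counting +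
Hoeffding + promise-Lautemann; PROVED, peaMemPH_proof); PhCollapse (NP ⊆ P → PH ⊆ P; PROVED);
CookModelBridge (PNPWave0.P Bool = Classes.P ∧ PNPWave0.NP Bool = Nondeterministic.NP, the proved
model bridges, filed as an item so the route file imports no ClayProblem module; PROVED);
PeaDegreeReduction (∀ d, PEA_d ≤_Karp PEA_3: branching program + AIK degree-3 perfect encoding +
H(p̂(U)) = H(p(U)) + |r| [DGRV Thm 4.5–4.6; AGMTW Lemma 10]; PROVED); PeaThreeMemBPP (negative side
= kill switch: PEA_3 ∈ prBPP' ⟺ SZKP_L ⊆ prBPP; open); PeaWorstToAvg (consequence side / kill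
infrastructure: PEA_3 ∉ prBPP' ⟹ a promise-supported samplable ensemble D with ((PEA_3).yes, D) ∉
HeurBPP — DGRV's worst-case→average-case programme [DvirGutfreundRothblumVadhan2010 pp.2–3;
BogdanovTrevisan2006]; open; implied vacuously by PeaThreeMemBPP; PeaWorstToAvg ∨ X landed, so never
a `closes` hypothesis); PeaTwoMemBPP (negative side, rung 1: PEA_2 over F_2 ∈ prBPP'; implied by
PeaThreeMemBPP (landed szkEntropy_not_peaTwoMemBPP_imp_not_peaThreeMemBPP: promise-BPP is antitone
in the promise and the PEA_d instance sets grow with d); open both ways — DGRV's derivative-rank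
algorithm [Thm 5.3, Lemma 5.2] needs odd q, at q = 2 Frobenius is linear; the exact F_2 tool is
Parseval + Dickson/Arf, 2^{−H_2} = 2^{−m} Σ_λ bias(λ·q)^2, i.e. a weighted MinRank-type census of
the pencil {λ·q} [BussFrandsenShallit1999], and Shannon vs Rényi is the residual gap). Assembly
(rank 1, PROVED) = the type of `closes` over the route's decl names, PeaThreeNotInP → PeaMemPH →
PhCollapse → CookModelBridge → PneNP.
KILL CRITERIA. PeaThreeMemBPP proved (SZKP_L ⊆ prBPP: GI, QR, DLOG, GapCVP_√n all easy) refutes X up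
to prP = prBPP and closes the route — spectacular either way. PeaTwoMemBPP proved does NOT close it
(pivot: hardness starts exactly at degree 3; push algorithmic regularity
[Bhattacharyya–Hatami–Tulsiani arXiv:1311.5090] to cubic systems whose biased members have partition
rank O(log n)); PeaTwoMemBPP refuted proves X. A Karp/Cook NP-hardness proof for PEA_3 would
collapse PH (Boppana–Håstad–Zachos) — never a tool here. Literature check (b) of the card done: no
PEA follow-up settles average-case hardness or PEA_2 over F_2 (AHT 2026, AGMTW 2025, AGHR 2023
read/grepped). AVERAGE-CASE WIRING OF THE KILL SIDE (the realisable content of the judge's request):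
PeaWorstToAvg, once PROVED in the explicit form its lines aim at — a NAMED samplable on-promise
ensemble D* (orbit-pair-rsr: GL × GL-randomised direct products of an entropy-separated orbit pair;
dual-mode-compile: a certified ModeKit of affine ⊕-branching-program entropy instances) — turns the
kill of X' = ¬PeaThreeMemBPP from WORST-case ("put SZKP_L in prBPP") into AVERAGE-case: any
heuristic scheme for ((PEA_3).yes, D*) refutes X' by the contrapositive (and X up to prP = prBPP),
and heuristics for an explicit D* are testable by kit experiments (cf. the standing disprover's job
j009530: random vs planted-kernel cubic maps, flattening-rank detector). In the other direction,
restricted-model LOWER bounds — average-case on such ensembles, or worst-case on instance families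
as already landed for the degree-2 rung (census-reading and directional-derivative-profile
algorithms are provably blind: Theorems/PeaTwoMemBPP/Negative/CensusDoesNotDetermineEntropy.lean,
DirectionalProfilesDoNotDetermineEntropy.lean) — are EVIDENCE for X and dead-technique records for
the kill ladder; they do not and cannot DEDUCE X — Ω(n)-wise-independent code ensembles fool every
low-degree statistic yet fall to decoding / Gaussian elimination [HolmgrenWein2021 Thm 2 =
Literature.Barriers.PneNP.LowDegreeCounterexamples], and cubic-map ensembles are of exactly this
F_2-algebraic kind.
NOT DECOMPOSED YET. Above all X itself: no decomposition of X into cruxes that FEED `closes` is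
known, and the inventory of what was examined (revs 4–7) is negative: (a) consequence-side
statements (PeaWorstToAvg; OWF / PRG from SZK_L-hardness) — eliminable by the landed disjunction
PeaWorstToAvg ∨ X (RANKED CRUXES); (b) "restricted-model average-case bound B(M, D) + simulation W:
PEA_3 ∈ prP ⟹ (PEA_3, D) solvable in model M on average" — for every model M that has average-case
lower-bound technology (AC^0; AC^0[⊕] and F_2-polynomials of degree o(√n) [Razborov1987;
Smolensky1987]; statistical-query / low-degree likelihood ratio [Hopkins2018;
KuniskyWeinBandeira2019]; monotone) the simulation W is FALSE for generic polynomial-time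
computation (Majority; decoding / Gaussian elimination —
Literature.Barriers.PneNP.LowDegreeCounterexamples), and restricted to algorithms that SOLVE PEA_3
on supp D its conclusion is a fixed property of the target function, so given B the statement W is
equivalent to X itself (costume) unless W carries its own proof; a W proved from the self-reducible
structure of PEA_3 would be a HARDNESS-MAGNIFICATION theorem for entropy approximation — none is in
print (magnification is known for compression / meta-complexity problems MCSP[s], MK^tP whose
small-parameter instances kernelise [McKayMurrayWilliams2019; arXiv:1911.08297 §1.1]; a PEA_3
instance is its own cubic map, has no sparse regime, and truth-table entropy is exactly computable
in polynomial time), one that appeared would face Literature.Barriers.PneNP.Locality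
[arXiv:1911.08297], and it would be a new thesis (its own route), not a child of X; (c)
class-internal splits X ⇐ (PEA_3 ∈ prP → PEA_3 ∈ prC) ∧ (PEA_3 ∉ prC) for C = L, NC^1, Formula[n^k]
— the first conjunct needs a downward / parallel self-reduction of which PEA shows no sign
(conditioning on half the input splits H(p(U_n)) into 2^{n/2} fibre terms), the second is a lower
bound beyond reach for every C ⊇ NC^1. So the route stays the conditional bridge PneNP ⇐ X with X
its single crux; crux-level effort (ideation, lines, disproof) belongs on X — a lower-bound
MECHANISM for cubic-map entropy; the card's dictionary (entropy ↔ Walsh spectrum ↔ partition-rank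
census of the linear system {λ·p}) is so far a language for INSTANCES, not a lower-bound mechanism —
and on the kill ladder, not on consequence-side statements. Also deliberately left open: the
Shannon-entropy census formula (H vs rank data of {λ·p}; the Shannon/Rényi gap is unbounded, e.g. p
= (x_1, x_1x_2, …, x_1x_m)); SZK_L/NISZK_L as Lean classes (not needed: X is about PEA_3 itself, per
the refuter audit's Watson caveat [Watson2016 §4]); the MKTP bridge; the quantum angle
(Aharonov–Ta-Shma QSG for cubic maps, DGRV p.3); odd-characteristic PEA; the explicit hard ensemble
D* of the average-case side (it must exclude Ω(n)-wise-independence pathologies explicitly). The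
definition Literature.Computability.Complexity.PEA has LANDED (PolynomialEntropyApproximation.lean;
Iff.rfl-equal to the items) but imports Literature.Computability.Cryptography.LiuPassCondEPPRG for
mapEntropy; items keep the inline Mathlib spelling until mapEntropy/fiber live in a
cryptography-free module, after which a tenure `--restate` to `PEA d` changes nothing up to defeq.
CHEAPEST FALSIFIER. Bibliographic first, then one computation: (1) grep the EA_{NC0}/SZK_L
literature after AGMTW 2025 / AHT 2026 for an algorithm putting entropy approximation of 4-local or
cubic maps with k = m − O(1) in prBPP (via PeaDegreeReduction this kills X outright) — done twice
(card audit + plancard), nothing found; (2) the degree-2 rung on a laptop: for random vs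
planted-low-rank quadratic maps q : F_2^n → F_2^m with n ≤ 24, m ≤ 16, compute H(q(U_n)) exactly
(2^24 evaluations) and the Dickson/Arf rank census of the pencil {λ·q}; if the census alone predicts
H to within 1/2 on all samples, PeaTwoMemBPP is very likely TRUE and the line must show the census
breaks at degree 3 (pivot, not kill); if PeaThreeMemBPP-type regularity algorithms [arXiv:1311.5090]
extend the census to cubics of partition rank O(log n), X is in danger.

Novelty: Searched before claiming (this session, 2026-08-15): crossref ×4 ("entropy polynomial mappings Dvir
Gutfreund Rothblum Vadhan" — DGRV is not DOI-registered, held now as lit paper:url-12143bc403a2 =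
ECCC TR10-160, READ pp.1–13, 20–21; "entropy approximation low-degree polynomial maps finite field
algorithm" 2011– → 0 relevant; "Kolmogorov complexity characterizes statistical zero knowledge" →
doi:10.1145/3795688 and the follow-up doi:10.1145/3708508, READ pp.1–4, 10, 23), zbMATH ×2 ("entropy
polynomial map finite field zero knowledge", "statistical zero knowledge logarithmic space complete
problem" → 0 relevant), lean search (no SZK/AM-promise/partition-rank in tree; HasSliceRankLE,
mapEntropy, Stockmeyer, Sipser–Gács–Lautemann found); local index, galaxy, OpenAlex, S2, arXiv
endpoints were down or rate-limited (rc 75/429) during the session — the card's two refuter novelty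
audits (2026-08-15) cover lit search/vsearch/frontier and Watson TR12-070. Nearest prior art FOUND:
DvirGutfreundRothblumVadhan2010 (defines PEA/PED, proves SZKP_L-completeness of PED_{F2,3} Thm 4.7,
the Rényi = Σ bias² dictionary Claim 5.6 and the odd-q quadratic algorithm Thm 5.3, and STATES the
worst-case/average-case and algebraic-characterisation programme pp.2–3);
AllenderGouwarHiraharaRobelle2023 + AllenderGrayMutrejaTirumalaWang2025 (NISZK_L, EA_{NC0} complete
with k = n−3, robustness of SZK_L, MKTP hard under projections) and AllenderHiraharaTirumala2026
(Kolmogorov characterisation of SZK/SZK_L);  [refs: 10.1145/3795688, 10.1145/3708508, 10.1007/s00039-019-00505-4, 10.1215/00127094-2022-0086, 10.1145/636865.636868, paper:url-12143bc403a2, doi:10.1145/3795688, doi:10.1145/3708508, doi:10.1007/s00039-019-00505-4, doi:10.1215/00127094-2022-0086, doi:10.1145/636865.636868, DvirGutfreundRothblumVadhan2010, AllenderGouwarHiraharaRobelle2023, AllenderGrayMutrejaTirumalaWang2025, AllenderHiraharaTirumala2]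

Barriers (technique_class: szk-hardness, partition-rank, worst-case-to-average-case): technique_class: szk-hardness, partition-rank, worst-case-to-average-case  (also:
entropy-approximation, higher-order-fourier-analysis, random-self-reduction)
- Literature.Barriers.PneNP.NPHardnessToOneWayFunctions: does not apply to PeaHardImpliesOwf — the
worst-case problem being self-reduced is SZKP_L-complete and lies in AM ∩ coAM (DGRV pp.2–3 make
exactly this point), so the AkaviaEtAl2006/BogdanovTrevisan2006 conclusions (coNP ⊆ AM-type
collapses from non-adaptive reductions) are vacuous; it bites in full if anyone routes NP-hardness →
PEA, which the route forbids (kill criterion).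
- Literature.Barriers.PneNP.HardnessAmplificationRequiresMajority: not engaged — no black-box
hardness amplification computed inside a small circuit class is proposed; the sought self-reduction
acts on INSTANCES (cubic maps under GL_n × GL_m and direct products) with a BPP-level reduction, and
its target is average-case hardness for polynomial time, not (1/2 − ε)-hardness against low-depth
circuits.
- Literature.Barriers.PneNP.LatticeGapCoNP: applies in spirit and is conceded by design — PEA_3 ∈
prAM ∩ pr-coAM, so Karp/Cook NP-hardness of PEA_3 collapses PH (Boppana–Håstad–Zachos), exactly as
for GapSVP_√n; the route never argues from NP-hardness, the hardness must come from a direct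
structural/average-case theory of cubic maps.
- Literature.Barriers.PneNP.Relativization: applies by inheritance (X ⟹ PneNP by a relativizing
collapse; SZK ⊆ PSPACE, so X fails relative to a PSPACE-complete oracl

History (route lifecycle, newest last):
- 2026-08-15T16:23:40Z · rev 2: restated PeaThreeNotInP (stmt-PneNP-1499), PeaHardImpliesOwf (stmt-PneNP-1501), PeaTwoMemBPP (stmt-PneNP-1502), PeaMemPH (stmt-PneNP-1500), PeaDegreeReduction (stmt-PneNP-1504), PeaThreeMemBPP (stmt-PneNP-1505), Assembly (stmt-PneNP-1506) — route-repair (rbadge cone guardrail + glue; planner-rbadge-PneNP-SzkEntr (planner-rbadge-PneNP-SzkEntropy-192dbecc-g2-0)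
- 2026-08-15T23:00:34Z · rev 3: restated CookModelBridge (stmt-PneNP-10679 proved), PhCollapse (stmt-PneNP-1503 proved), Assembly (stmt-PneNP-10782 proved) — route-repair rev 3 (glue-native-fail; planner-rglue-PneNP-SzkEntropy-192dbecc-0): deciding theorem `closes (hX : PeaThreeNotInP) (hPH : PeaMemPH) (hC : PhCollap (planner-rglue-PneNP-SzkEntropy-192dbecc-0)
- 2026-08-15T23:00:34Z · rev 3: dropped stmt-PneNP-10688 — route-repair rev 3 (glue-native-fail; planner-rglue-PneNP-SzkEntropy-192dbecc-0): deciding theorem `closes (hX : PeaThreeNotInP) (hPH : PeaMemPH) (hC : PhCollap (planner-rglue-PneNP-SzkEntropy-192dbecc-0)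
- 2026-08-16T04:14:42Z · AUTO-CRUX (backfill): PeaThreeNotInP — hypotheses of the deciding theorem that nothing in the route derives are cruxes (operator:999:1085951)
- 2026-08-22T09:23:40Z · DORMANT — reconciler: no traction for 5.2 d (last activity item-evidence-added at 2026-08-17T03:05:40Z); parked, not closed — `ledger route dormant route-PneNP-SzkEntropy (operator:999:4161960)

sub-problem: PneNP · status: dormant · opened planner-plancard-PneNP-PneNP-szk-entropy-cubi-77d1b983-0 2026-08-15T10:57:01Z · rev 7 · ledger route-PneNP-SzkEntropy
GENERATED by the gate from the ledger (D-0016/17). Provers cite these decls: `theorem foo : Summit.PneNP.PneNP.Theses.SzkEntropy.<Decl> := …` in Summits/PneNP/PneNP/Theorems/<Name>.lean.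
-/

namespace Summit.PneNP.PneNP.Theses.SzkEntropy

open scoped BigOperators Topology Manifold Classical MeasureTheory ProbabilityTheory Matrix InnerProductSpace ComplexConjugate ContinuousMap
open Filter Set Function TopologicalSpace MeasureTheory

attribute [summit_statement] _root_.PneNP

open Literature.PNP

-- earlier PeaThreeNotInP (stmt-PneNP-1499, replaced 2026-08-15T16:23:40Z -> stmt-PneNP-10776): retired by None — let PEA : ℕ → Literature.Computability.Complexity.PromiseProblem := fun d => Literature.Computability.Complexity.PromiseProblem.ofEncoding (Computability.Encoding.sigmaBool fun n => ((Literature.Computability.Complexity.encodingFinBool n).listBool.listBool.listBool).pairBool Computability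
/-- item stmt-PneNP-10776 · crux (kind.auto-crux: conjecture-grade) · rank 0 · open · by planner
why it might fail: Bare hardness claim stronger than P≠NP, no lower-bound technique behind it: false as soon as SZKP_L ⊆ prP (GI — already quasi-poly, arXiv:1512.03547 — QR, DLOG/DDH, GapCVP_√n, PED_{F2,3} all easy); sole evidence is completeness [DGRV Thm 1.1/4.7] plus algorithmic failure.
sources: DvirGutfreundRothblumVadhan2010, SahaiVadhan2003, GoldreichVadhan1999, AllenderGrayMutrejaTirumalaWang2025, arXiv:1512.03547, lit paper:url-12143bc403a2 pp.2-4
[target] Thesis X of route SzkEntropy: PEA_3 ∉ PromiseP — no deterministic polynomial-time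
algorithm, given a cubic map p : F_2^n → F_2^m (sparse monomial lists: instance Σ n,
List(List(List(Fin n))) × ℕ, value of a monomial = product of the listed coordinates) and k ∈ ℕ,
accepts all instances with H(p(U_n)) ≥ k+1 and rejects all with H ≤ k (the `let ev/H/PEA := …`
prefix spells PEA_d over Mathlib + Complexity.Promise only: ev = value of the sparse map, H I =
Shannon entropy in bits of p(U_n) = (1/|F_2^n|) Σ_x log_2(|F_2^n| / #{x' : p(x') = p(x)}); rev-2
restatement DEFINITIONALLY EQUAL (Iff.rfl) to the rev ≤ 1 statement via
Literature.Computability.Cryptography.mapEntropy and to Literature.Computability.Complexity.PEA d —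
only the import cone changed). Equivalent to SZKP_L ⊄ prP [DvirGutfreundRothblumVadhan2010, Thm 1.1
= Thm 4.7 + §3 p.6 (PEA ≡ PED_{F2,3} under ≤2-query tt-reductions; gap 1 at integer k ≡ any additive
constant gap by t-fold direct products p^{×t}, which stay cubic; tree: PolyMapF2.entropy_prod); lit
paper:url-12143bc403a2]. Open. Why it might fail: SZKP_L ⊆ prBPP is consistent with everything known
(GI is already quasi-polynomial); X is stronger than P ≠ NP. -/
@[route_item "route-PneNP-SzkEntropy", crux]
def PeaThreeNotInP : Prop :=
  let ev : (n : ℕ) → List (List (List (Fin n))) → (Fin n → ZMod 2) → List (ZMod 2) := fun n P x => P.map fun p => (p.map fun μ => (μ.map x).prod).sum; let H : (Σ n : ℕ, List (List (List (Fin n))) × ℕ) → ℝ := fun I => (∑ x : Fin I.1 → ZMod 2, Real.logb 2 (((Finset.univ : Finset (Fin I.1 → ZMod 2)).card : ℝ) / (Finset.univ.filter fun x' : Fin I.1 → ZMod 2 => ev I.1 I.2.1 x' = ev I.1 I.2.1 x).card)) / (Finset.univ : Finset (Fin I.1 → ZMod 2)).card; let PEA : ℕ → Literature.Computability.Complexity.PromiseProblem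 := fun d => Literature.Computability.Complexity.PromiseProblem.ofEncoding (Computability.Encoding.sigmaBool fun n => ((Literature.Computability.Complexity.encodingFinBool n).listBool.listBool.listBool).pairBool Computability.encodingNatBool) {I : (Σ n : ℕ, List (List (List (Fin n))) × ℕ) | (∀ p ∈ I.2.1, ∀ μ ∈ p, μ.length ≤ d) ∧ (I.2.2 : ℝ) + 1 ≤ H I} {I : (Σ n : ℕ, List (List (List (Fin n))) × ℕ) | (∀ p ∈ I.2.1, ∀ μ ∈ p, μ.length ≤ d) ∧ H I ≤ (I.2.2 : ℝ)}; PEA 3 ∉ Literature.Computability.Complexity.PromiseP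

-- earlier PeaMemPH (stmt-PneNP-1500, replaced 2026-08-15T16:23:40Z -> stmt-PneNP-10779): retired by None — let PEA : ℕ → Literature.Computability.Complexity.PromiseProblem := fun d => Literature.Computability.Complexity.PromiseProblem.ofEncoding (Computability.Encoding.sigmaBool fun n => ((Literature.Computability.Complexity.encodingFinBool n).listBool.listBool.listBool).pairBool Computability.encod
/-- item stmt-PneNP-10779 · support · rank 2 · closed · proved by Summit.PneNP.PneNP.Theorems.peaMemPH_proof (prover) · by planner
why it might fail: Cannot fail mathematically (EA-type problems for explicit poly-time maps are in prBPP^NP ⊆ prΣ3 by Stockmeyer counting + Lautemann; also SZK ⊆ AM ⊆ Π2). Risk is formal: a TM2 poly-time evaluator for the sparse cubic-map encoding and an oracle/promise Lautemann must be built in the tree.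
sources: GoldreichSahaiVadhan1999, AielloHastad1991, BabaiMoran1988, Stockmeyer1985, Sipser1983, DvirGutfreundRothblumVadhan2010
[support — KNOWN IN PRINT; the one PEA fact the deciding theorem `closes` needs] For every degree
bound d, PEA_d ∈ promiseLift PH: some language of the polynomial hierarchy contains every
yes-instance (deg ≤ d, H ≥ k+1) and no no-instance (deg ≤ d, H ≤ k) (the `let ev/H/PEA := …` prefix
spells PEA_d over Mathlib + Complexity.Promise only: ev = value of the sparse map, H I = Shannon
entropy in bits of p(U_n) = (1/|F_2^n|) Σ_x log_2(|F_2^n| / #{x' : p(x') = p(x)}); rev-2 restatement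
DEFINITIONALLY EQUAL (Iff.rfl) to the rev ≤ 1 statement via
Literature.Computability.Cryptography.mapEntropy and to Literature.Computability.Complexity.PEA d —
only the import cone changed). Two printed routes: (a) PEA_d ≤_Karp PED_{F2,3} ∈ SZKP_L ⊆ SZK ⊆ AM ∩
coAM [DvirGutfreundRothblumVadhan2010 Thm 4.7, Lemma 4.9; AielloHastad1991; Fortnow 1987] and prAM ⊆
promiseLift (PiP 2) [BabaiMoran1988]; (b) DIRECT and recommended for the tree: H(p(U_n)) = n −
2^{−n} Σ_x log_2 |p^{−1}(p(x))|, so sample x_1..x_T (T = O(n^2)), estimate each fibre size |{x' :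
p(x') = p(x_i)}| within factor 1 ± 1/16 with Stockmeyer's NP-oracle counting (the relation 'p(x') =
p(x)' is in P once a TM2 evaluator for the sparse encoding -/
@[route_item "route-PneNP-SzkEntropy", crux]
def PeaMemPH : Prop :=
  let ev : (n : ℕ) → List (List (List (Fin n))) → (Fin n → ZMod 2) → List (ZMod 2) := fun n P x => P.map fun p => (p.map fun μ => (μ.map x).prod).sum; let H : (Σ n : ℕ, List (List (List (Fin n))) × ℕ) → ℝ := fun I => (∑ x : Fin I.1 → ZMod 2, Real.logb 2 (((Finset.univ : Finset (Fin I.1 → ZMod 2)).card : ℝ) / (Finset.univ.filter fun x' : Fin I.1 → ZMod 2 => ev I.1 I.2.1 x' = ev I.1 I.2.1 x).card)) / (Finset.univ : Finset (Fin I.1 → ZMod 2)).card; let PEA : ℕ → Literature.Computability.Complexity.PromiseProblem := fun d => Literature.Computability.Complexity.PromiseProblem.ofEncoding (Computability.Encoding.sigmaBool fun n => ((Literature.Computability.Complexity.encodingFinBool n).listBool.listBool.listBool).pairBool Computability.encodingNatBool) {I : (Σ n : ℕ, List (List (List (Fin n))) × ℕ) | (∀ p ∈ I.2.1, ∀ μ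 ∈ p, μ.length ≤ d) ∧ (I.2.2 : ℝ) + 1 ≤ H I} {I : (Σ n : ℕ, List (List (List (Fin n))) × ℕ) | (∀ p ∈ I.2.1, ∀ μ ∈ p, μ.length ≤ d) ∧ H I ≤ (I.2.2 : ℝ)}; ∀ d : ℕ, PEA d ∈ Literature.Computability.Complexity.promiseLift Literature.Computability.Complexity.PH

/-- `PeaMemPH` holds: proved by `Summit.PneNP.PneNP.Theorems.peaMemPH_proof`. -/
theorem PeaMemPH_holds : PeaMemPH := _root_.Summit.PneNP.PneNP.Theorems.peaMemPH_proof

/-- item stmt-PneNP-10777 · support · rank 3 · open · by planner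
why it might fail: False in an 'SZK-Heuristica' (PEA_3 worst-case hard yet in HeurBPP on every samplable ensemble), nothing excludes it: worst-case SZK-hardness gives only auxiliary-input OWF [OstrovskyWigderson1993]; GL-rerandomisation fixes the iso class, hiding a worst-case map needs cross-orbit equidistribution.
sources: DvirGutfreundRothblumVadhan2010, OstrovskyWigderson1993, Ostrovsky1991, BogdanovTrevisan2006, HiraharaNanashima2024, lit paper:url-12143bc403a2 pp.2-4
[crux #3 — hardest / most informative; OPEN] WORST-CASE TO AVERAGE-CASE INSIDE CUBIC MAPS (replaces
PeaHardImpliesOwf of rev ≤ 1: same bet, conclusion moved one step upstream of one-way functions so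
that the statement lives over MetaComplexity.HeuristicClasses and no cryptographic named conjecture
enters the route's cone). If PEA_3 is worst-case hard for randomized polynomial time (PEA_3 ∉
PromiseBPP', the textbook promise-BPP with the 2/3-gap required on the promise only) then there is a
polynomial-time samplable ensemble D = (D_n) [BogdanovTrevisan2006 Def. 2.1; tree
Ensemble.IsPolySamplable] supported on the promise (every string in supp D_n is a yes- or a
no-instance of PEA_3 — satisfiable at every n, e.g. by the constant no-instance, cf. the BavardGap
negative) such that the distributional problem ((PEA_3).yes, D) is NOT in HeurBPP
[BogdanovTrevisan2006 Def. 2.12–2.13; tree HeurBPP]: no randomized heuristic scheme A(x,1^n,1^m)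
errs (w.p. ≥ 1/4 over its coins) on at most a 1/m fraction of D_n for all n, m. On the support,
deciding membership in `yes` IS solving the promise problem, so this is exactly 'PEA_3 ∉ prBPP ⟹
(PEA_3, D) ∉ HeurBPP for some samplable D' (the `let ev/H/PEA -/
@[route_item "route-PneNP-SzkEntropy"]
def PeaWorstToAvg : Prop :=
  let ev : (n : ℕ) → List (List (List (Fin n))) → (Fin n → ZMod 2) → List (ZMod 2) := fun n P x => P.map fun p => (p.map fun μ => (μ.map x).prod).sum; let H : (Σ n : ℕ, List (List (List (Fin n))) × ℕ) → ℝ := fun I => (∑ x : Fin I.1 → ZMod 2, Real.logb 2 (((Finset.univ : Finset (Fin I.1 → ZMod 2)).card : ℝ) / (Finset.univ.filter fun x' : Fin I.1 → ZMod 2 => ev I.1 I.2.1 x' = ev I.1 I.2.1 x).card)) / (Finset.univ : Finset (Fin I.1 → ZMod 2)).card; let PEA : ℕ → Literature.Computability.Complexity.PromiseProblem := fun d => Literature.Computability.Complexity.PromiseProblem.ofEncoding (Computability.Encoding.sigmaBool fun n => ((Literature.Computability.Complexity.encodingFinBool n).listBool.listBool.listBool).pairBool Computability.encodingNatBool) {I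 : (Σ n : ℕ, List (List (List (Fin n))) × ℕ) | (∀ p ∈ I.2.1, ∀ μ ∈ p, μ.length ≤ d) ∧ (I.2.2 : ℝ) + 1 ≤ H I} {I : (Σ n : ℕ, List (List (List (Fin n))) × ℕ) | (∀ p ∈ I.2.1, ∀ μ ∈ p, μ.length ≤ d) ∧ H I ≤ (I.2.2 : ℝ)}; PEA 3 ∉ Literature.Computability.Complexity.PromiseBPP' → ∃ D : Literature.Computability.MetaComplexity.Ensemble, D.IsPolySamplable ∧ (∀ n : ℕ, ∀ w ∈ (D n).support, w ∈ (PEA 3).yes ∨ w ∈ (PEA 3).no) ∧ Literature.Computability.MetaComplexity.DistProblem.mk (PEA 3).yes D ∉ Literature.Computability.MetaComplexity.HeurBPP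

-- earlier PeaTwoMemBPP (stmt-PneNP-1502, replaced 2026-08-15T16:23:40Z -> stmt-PneNP-10778): retired by None — let PEA : ℕ → Literature.Computability.Complexity.PromiseProblem := fun d => Literature.Computability.Complexity.PromiseProblem.ofEncoding (Computability.Encoding.sigmaBool fun n => ((Literature.Computability.Complexity.encodingFinBool n).listBool.listBool.listBool).pairBool Computability.e
/-- item stmt-PneNP-10778 · support · rank 4 · open · by planner
why it might fail: May be false: gap-1 Shannon entropy of quadratic maps over F_2 needs a weighted census of low-rank forms in the pencil {λ·q} (MinRank-type; MinRank NP-hard [BussFrandsenShallit1999]); the one printed algorithm [DGRV Thm 5.3] needs prime q≠2, homogeneity, a factor-2 Shannon/Rényi gap — dies at q=2.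
sources: DvirGutfreundRothblumVadhan2010, BussFrandsenShallit1999, ApplebaumIshaiKushilevitz2006, lit paper:url-12143bc403a2 pp.14-18
[crux #4 — first rung of the algorithmic ladder / negative side, OPEN both ways] PEA_2 over F_2 (all
monomials of length ≤ 2: quadratic maps q = (q_1,…,q_m), constants and hidden linear terms x_i^2 =
x_i allowed) is in textbook promise-BPP (the `let ev/H/PEA := …` prefix spells PEA_d over Mathlib +
Complexity.Promise only: ev = value of the sparse map, H I = Shannon entropy in bits of p(U_n) =
(1/|F_2^n|) Σ_x log_2(|F_2^n| / #{x' : p(x') = p(x)}); rev-2 restatement DEFINITIONALLY EQUAL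
(Iff.rfl) to the rev ≤ 1 statement via Literature.Computability.Cryptography.mapEntropy and to
Literature.Computability.Complexity.PEA d — only the import cone changed). DGRV solve only prime q ≠
2, homogeneous quadratics, and only 'Shannon entropy < k·log q vs Rényi entropy ≥ 2k·log q + 1' via
E_a q^{−rank D_a q} = 2^{−H_Rényi} [DvirGutfreundRothblumVadhan2010 Lemma 5.2, Thm 5.3, Claim 5.5];
at q = 2 the Frobenius x ↦ x^2 is linear, D_a(x_i^2) is constant, Claim 5.5 fails and with it the
derivative-rank formula (e.g. q_i = x_i^2: every D_a q is constant yet H = n). Over F_2 the exact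
tool is Parseval + Dickson/Arf: 2^{−H_2(q(U))} = 2^{−m} Σ_λ bias(λ·q)^2 with bias(λ·q)^2 ∈ {0,
2^{−2h(λ)}} computable -/
@[route_item "route-PneNP-SzkEntropy"]
def PeaTwoMemBPP : Prop :=
  let ev : (n : ℕ) → List (List (List (Fin n))) → (Fin n → ZMod 2) → List (ZMod 2) := fun n P x => P.map fun p => (p.map fun μ => (μ.map x).prod).sum; let H : (Σ n : ℕ, List (List (List (Fin n))) × ℕ) → ℝ := fun I => (∑ x : Fin I.1 → ZMod 2, Real.logb 2 (((Finset.univ : Finset (Fin I.1 → ZMod 2)).card : ℝ) / (Finset.univ.filter fun x' : Fin I.1 → ZMod 2 => ev I.1 I.2.1 x' = ev I.1 I.2.1 x).card)) / (Finset.univ : Finset (Fin I.1 → ZMod 2)).card; let PEA : ℕ → Literature.Computability.Complexity.PromiseProblem := fun d => Literature.Computability.Complexity.PromiseProblem.ofEncoding (Computability.Encoding.sigmaBool fun n => ((Literature.Computability.Complexity.encodingFinBool n).listBool.listBool.listBool).pairBool Computability.encodingNatBool) {I : (Σ n : ℕ, List (List (List (Fin n))) × ℕ) | (∀ p ∈ I.2.1,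 ∀ μ ∈ p, μ.length ≤ d) ∧ (I.2.2 : ℝ) + 1 ≤ H I} {I : (Σ n : ℕ, List (List (List (Fin n))) × ℕ) | (∀ p ∈ I.2.1, ∀ μ ∈ p, μ.length ≤ d) ∧ H I ≤ (I.2.2 : ℝ)}; PEA 2 ∈ Literature.Computability.Complexity.PromiseBPP'

-- earlier PeaDegreeReduction (stmt-PneNP-1504, replaced 2026-08-15T16:23:40Z -> stmt-PneNP-10780): retired by None — let PEA : ℕ → Literature.Computability.Complexity.PromiseProblem := fun d => Literature.Computability.Complexity.PromiseProblem.ofEncoding (Computability.Encoding.sigmaBool fun n => ((Literature.Computability.Complexity.encodingFinBool n).listBool.listBool.listBool).pairBool Computabi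
/-- item stmt-PneNP-10780 · support · rank 9 · closed · proved by Summit.PneNP.PneNP.Theorems.szkEntropy_peaDegreeReduction_proof @ b8e69f66a55b (prover) · by planner
sources: DvirGutfreundRothblumVadhan2010, ApplebaumIshaiKushilevitz2006, AllenderGrayMutrejaTirumalaWang2025
[support — KNOWN; documents the degree dial] For every d, PEA_d Karp-reduces (promise reduction in
FP, yes ↦ yes, no ↦ no; tree PromiseProblem.PolyTimeReducible) to PEA_3 (the `let ev/H/PEA := …`
prefix spells PEA_d over Mathlib + Complexity.Promise only: ev = value of the sparse map, H I =
Shannon entropy in bits of p(U_n) = (1/|F_2^n|) Σ_x log_2(|F_2^n| / #{x' : p(x') = p(x)}); rev-2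
restatement DEFINITIONALLY EQUAL (Iff.rfl) to the rev ≤ 1 statement via
Literature.Computability.Cryptography.mapEntropy and to Literature.Computability.Complexity.PEA d —
only the import cone changed): build a polynomial-size branching program computing x ↦ p(x) from the
sparse degree-d map (evaluate monomials one at a time), apply the Ishai–Kushilevitz / AIK PERFECT
degree-3 randomized encoding p̂(x, r) over F_2 [ApplebaumIshaiKushilevitz2006;
DvirGutfreundRothblumVadhan2010 Thm 4.5], and use H(p̂(U_n, U_s)) = H(p(U_n)) + s for perfect
encodings [DvirGutfreundRothblumVadhan2010 proof of Thm 4.6; AllenderGrayMutrejaTirumalaWang2025,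
Lemma 10], mapping (p, k) ↦ (p̂, k + s). So the entropy-approximation problem does not get harder
beyond degree 3 (d = 1 is matrix rank over F_2, DGRV p.1; d = 2 over F_ -/
@[route_item "route-PneNP-SzkEntropy", crux]
def PeaDegreeReduction : Prop :=
  let ev : (n : ℕ) → List (List (List (Fin n))) → (Fin n → ZMod 2) → List (ZMod 2) := fun n P x => P.map fun p => (p.map fun μ => (μ.map x).prod).sum; let H : (Σ n : ℕ, List (List (List (Fin n))) × ℕ) → ℝ := fun I => (∑ x : Fin I.1 → ZMod 2, Real.logb 2 (((Finset.univ : Finset (Fin I.1 → ZMod 2)).card : ℝ) / (Finset.univ.filter fun x' : Fin I.1 → ZMod 2 => ev I.1 I.2.1 x' = ev I.1 I.2.1 x).card)) / (Finset.univ : Finset (Fin I.1 → ZMod 2)).card; let PEA : ℕ → Literature.Computability.Complexity.PromiseProblem := fun d => Literature.Computability.Complexity.PromiseProblem.ofEncoding (Computability.Encoding.sigmaBool fun n => ((Literature.Computability.Complexity.encodingFinBool n).listBool.listBool.listBool).pairBool Computability.encodingNatBool) {I : (Σ n : ℕ, List (List (List (Fin n))) × ℕ) | (∀ p ∈ I.2.1,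 ∀ μ ∈ p, μ.length ≤ d) ∧ (I.2.2 : ℝ) + 1 ≤ H I} {I : (Σ n : ℕ, List (List (List (Fin n))) × ℕ) | (∀ p ∈ I.2.1, ∀ μ ∈ p, μ.length ≤ d) ∧ H I ≤ (I.2.2 : ℝ)}; ∀ d : ℕ, (PEA d).PolyTimeReducible (PEA 3)

-- earlier PeaThreeMemBPP (stmt-PneNP-1505, replaced 2026-08-15T16:23:40Z -> stmt-PneNP-10781): retired by None — let PEA : ℕ → Literature.Computability.Complexity.PromiseProblem := fun d => Literature.Computability.Complexity.PromiseProblem.ofEncoding (Computability.Encoding.sigmaBool fun n => ((Literature.Computability.Complexity.encodingFinBool n).listBool.listBool.listBool).pairBool Computability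
/-- item stmt-PneNP-10781 · support · rank 9 · open · by planner
sources: DvirGutfreundRothblumVadhan2010, arXiv:1311.5090
[support — NEGATIVE SIDE / kill switch, filed so the refuting direction has a target] PEA_3 ∈
textbook promise-BPP (the `let ev/H/PEA := …` prefix spells PEA_d over Mathlib + Complexity.Promise
only: ev = value of the sparse map, H I = Shannon entropy in bits of p(U_n) = (1/|F_2^n|) Σ_x
log_2(|F_2^n| / #{x' : p(x') = p(x)}); rev-2 restatement DEFINITIONALLY EQUAL (Iff.rfl) to the rev ≤
1 statement via Literature.Computability.Cryptography.mapEntropy and to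
Literature.Computability.Complexity.PEA d — only the import cone changed), i.e. SZKP_L ⊆ prBPP:
Graph Isomorphism, Quadratic Residuosity, DDH/DLOG, GapCVP_√n would all be in BPP
[DvirGutfreundRothblumVadhan2010 §4.4]. Proving it closes route SzkEntropy (and much of
cryptography). The plausible path is the algorithmic-regularity ladder: PeaTwoMemBPP, then cubic
systems all of whose biased combinations have partition rank O(log n) via algorithmic regularity
lemmas (Bhattacharyya–Hatami–Tulsiani, arXiv:1311.5090), then a census argument for the general
case. -/
@[route_item "route-PneNP-SzkEntropy", crux]
def PeaThreeMemBPP : Prop :=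
  let ev : (n : ℕ) → List (List (List (Fin n))) → (Fin n → ZMod 2) → List (ZMod 2) := fun n P x => P.map fun p => (p.map fun μ => (μ.map x).prod).sum; let H : (Σ n : ℕ, List (List (List (Fin n))) × ℕ) → ℝ := fun I => (∑ x : Fin I.1 → ZMod 2, Real.logb 2 (((Finset.univ : Finset (Fin I.1 → ZMod 2)).card : ℝ) / (Finset.univ.filter fun x' : Fin I.1 → ZMod 2 => ev I.1 I.2.1 x' = ev I.1 I.2.1 x).card)) / (Finset.univ : Finset (Fin I.1 → ZMod 2)).card; let PEA : ℕ → Literature.Computability.Complexity.PromiseProblem := fun d => Literature.Computability.Complexity.PromiseProblem.ofEncoding (Computability.Encoding.sigmaBool fun n => ((Literature.Computability.Complexity.encodingFinBool n).listBool.listBool.listBool).pairBool Computability.encodingNatBool) {I : (Σ n : ℕ, List (List (List (Fin n))) × ℕ) | (∀ p ∈ I.2.1, ∀ μ ∈ p, μ.length ≤ d) ∧ (I.2.2 : ℝ) + 1 ≤ H I} {I : (Σ n : ℕ, List (List (List (Fin n))) × ℕ) | (∀ p ∈ I.2.1, ∀ μ ∈ p, μ.length ≤ d) ∧ H I ≤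 (I.2.2 : ℝ)}; PEA 3 ∈ Literature.Computability.Complexity.PromiseBPP'

-- earlier CookModelBridge (stmt-PneNP-10679, replaced 2026-08-15T23:00:34Z -> stmt-PneNP-13908): proved by Summit.PneNP.PneNP.Theorems.cookModelBridge_proof @ a9cf7dce24c0 — Literature.Computability.Complexity.PNPWave0.P Bool = Literature.Computability.Complexity.Classes.P ∧ Literature.Computability.Complexity.PNPWave0.NP Bool = Literature.Computability.Complexity.Nondeterministic.NP
/-- item stmt-PneNP-13908 · support · rank 9 · closed · proved by Summit.PneNP.PneNP.Theorems.szkEntropy_cookModelBridge_standalone (prover) · by planner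
[support — KNOWN, PROVED in the tree; model bridge used by the deciding theorem `closes`] Cook's
Clay-problem classes over {0,1} (PNPWave0.P Bool, PNPWave0.NP Bool, in which the summit statement
PneNP is phrased) coincide with the tree's working classes Classes.P = ⋃_k DTIME(n^k) and
Nondeterministic.NP = polyExists P [AroraBarakCC2009 Def. 1.13 and 2.1; CookClay2006 §1]. Same term
as stmt-PneNP-10679 (spelled `And (…) (…)`), whose proof
Summit.PneNP.PneNP.Theorems.cookModelBridge_proof (Theorems/SzkEntropyCookModelBridge.lean, =
⟨p_bool_eq, CookBridges.np_bool_eq⟩) still proves THIS decl by name and still serves routes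
DelsarteLasserre / LatticeMagic / OverlapGapAlgebra (decl name and term unchanged on purpose). GATE
IMPORT-CYCLE GAP (2026-08-15): this item is the rev-3 RE-FILING, under the same decl name and with a
statement that parses to the IDENTICAL term (rfl), of an item already PROVED in the tree; it was
re-filed only because its proof lives in a Theorems module that `import`s this route file, and the
gate links proved items by auto-importing the proving module into the route file — a self-import
that makes every decl 'already declared' and de-certified the route (needs_mat -/
@[route_item "route-PneNP-SzkEntropy", crux]
def CookModelBridge : Prop :=
  And (Literature.Computability.Complexity.PNPWave0.P Bool = Literature.Computability.Complexity.Classes.P) (Literature.Computability.Complexity.PNPWave0.NP Bool = Literature.Computability.Complexity.Nondeterministic.NP)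

/-- `CookModelBridge` holds: proved by `Summit.PneNP.PneNP.Theorems.szkEntropy_cookModelBridge_standalone`. -/
theorem CookModelBridge_holds : CookModelBridge := _root_.Summit.PneNP.PneNP.Theorems.szkEntropy_cookModelBridge_standalone

-- earlier PhCollapse (stmt-PneNP-1503, replaced 2026-08-15T23:00:34Z -> stmt-PneNP-13909): proved by Summit.PneNP.PneNP.Theorems.szkEntropy_phCollapse_proof — Literature.Computability.Complexity.Nondeterministic.NP ⊆ Literature.Computability.Complexity.Classes.P → Literature.Computability.Complexity.PH ⊆ Literature.Computability.Complexity.Classes.P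
/-- item stmt-PneNP-13909 · support · rank 9 · closed · proved by Summit.PneNP.PneNP.Theorems.szkEntropy_phCollapse_standalone (prover) · by planner
sources: AroraBarakCC2009
[support — elementary, PROVED in the tree] NP ⊆ P ⟹ PH ⊆ P: by induction Σ_{k+1} = polyExists (co
Σ_k) ⊆ polyExists (co P) = polyExists P = NP ⊆ P (polyExists_mono, co_mono, co_P_holds, SigmaP_succ,
PiP_eq_co), then PH = ⋃_k Σ_k [AroraBarakCC2009, Thm 5.4]. Same term as stmt-PneNP-1503
(parenthesised), whose proof Summit.PneNP.PneNP.Theorems.szkEntropy_phCollapse_proof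
(Theorems/SzkEntropyPhCollapse.lean, with SigmaP_subset_P_of_NP_subset_P) still proves THIS decl by
name. GATE IMPORT-CYCLE GAP (2026-08-15): this item is the rev-3 RE-FILING, under the same decl name
and with a statement that parses to the IDENTICAL term (rfl), of an item already PROVED in the tree;
it was re-filed only because its proof lives in a Theorems module that `import`s this route file,
and the gate links proved items by auto-importing the proving module into the route file — a
self-import that makes every decl 'already declared' and de-certified the route (needs_materialise
22:32Z). TO CLOSE IT AGAIN: prove it from a file that does NOT import
Summits.PneNP.PneNP.Theses.SzkEntropy (nor any Theorems/SzkEntropy*.lean), stating the type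
structurally as written here; do NOT `workitem close --by` the existing ro -/
@[route_item "route-PneNP-SzkEntropy", crux]
def PhCollapse : Prop :=
  (Literature.Computability.Complexity.Nondeterministic.NP ⊆ Literature.Computability.Complexity.Classes.P) → (Literature.Computability.Complexity.PH ⊆ Literature.Computability.Complexity.Classes.P)

/-- `PhCollapse` holds: proved by `Summit.PneNP.PneNP.Theorems.szkEntropy_phCollapse_standalone`. -/
theorem PhCollapse_holds : PhCollapse := _root_.Summit.PneNP.PneNP.Theorems.szkEntropy_phCollapse_standalone

-- earlier Assembly (stmt-PneNP-10782, replaced 2026-08-15T23:00:34Z -> stmt-PneNP-13910): proved by Summit.PneNP.PneNP.Theorems.szkEntropy_assembly_proof — PeaThreeNotInP → PeaMemPH → PhCollapse → CookModelBridge → _root_.PneNP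
-- earlier Assembly (stmt-PneNP-1506, replaced 2026-08-15T16:23:40Z -> stmt-PneNP-10782): retired by None — let PEA : ℕ → Literature.Computability.Complexity.PromiseProblem := fun d => Literature.Computability.Complexity.PromiseProblem.ofEncoding (Computability.Encoding.sigmaBool fun n => ((Literature.Computability.Complexity.encodingFinBool n).listBool.listBool.listBool).pairBool Computability.encod
/-- item stmt-PneNP-13910 · assembly · rank 1 · closed · proved by Summit.PneNP.PneNP.Theorems.szkEntropy_assembly_standalone (prover) · by planner
sources: DvirGutfreundRothblumVadhan2010, AroraBarakCC2009
[assembly] X (PeaThreeNotInP: PEA_3 ∉ PromiseP) → PeaMemPH (∀ d, PEA_d ∈ promiseLift PH) →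
PhCollapse (NP ⊆ P → PH ⊆ P) → CookModelBridge (PNPWave0.P Bool = Classes.P ∧ PNPWave0.NP Bool =
Nondeterministic.NP) → PneNP — the deciding chain over the route's own decls, IDENTICAL to the type
of the certified deciding theorem `closes` of this file (if ¬PneNP then NP ⊆ P in Cook's model,
bridge to the tree's classes, PH ⊆ P, promiseLift PH ⊆ promiseLift P = PromiseP by promiseLift_mono,
so PEA_3 ∈ PromiseP, contradiction). Same term as stmt-PneNP-10782 (`PneNP` for `_root_.PneNP`),
whose proof Summit.PneNP.PneNP.Theorems.szkEntropy_assembly_proof (Theorems/SzkEntropyAssembly.lean,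
`exact closes`) still proves THIS decl by name. GATE IMPORT-CYCLE GAP (2026-08-15): this item is the
rev-3 RE-FILING, under the same decl name and with a statement that parses to the IDENTICAL term
(rfl), of an item already PROVED in the tree; it was re-filed only because its proof lives in a
Theorems module that `import`s this route file, and the gate links proved items by auto-importing
the proving module into the route file — a self-import that makes every decl 'already declared' and
de-certified the route (n -/
@[route_item "route-PneNP-SzkEntropy"]
def Assembly : Prop :=
  PeaThreeNotInP → PeaMemPH → PhCollapse → CookModelBridge → PneNP

/-- `Assembly` holds: proved by `Summit.PneNP.PneNP.Theorems.szkEntropy_assembly_standalone`. -/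
theorem Assembly_holds : Assembly := _root_.Summit.PneNP.PneNP.Theorems.szkEntropy_assembly_standalone

-- records of items no longer active in this route (dropped / restated):
-- earlier PeaHardImpliesOwf (stmt-PneNP-1501, replaced 2026-08-15T16:23:40Z -> stmt-PneNP-10777): retired by None — let PEA : ℕ → Literature.Computability.Complexity.PromiseProblem := fun d => Literature.Computability.Complexity.PromiseProblem.ofEncoding (Computability.Encoding.sigmaBool fun n => ((Literature.Computability.Complexity.encodingFinBool n).listBool.listBool.listBool).pairBool Computabil

/-! D-0027 §2.1 — DECIDING THEOREM (planner-authored via `route open/edit --closes-file`; by planner-rglue-PneNP-SzkEntropy-192dbecc-0 2026-08-15T23:00:34Z):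
its hypotheses are this route's items and its conclusion the sub-problem Statement (glue_lint), and it elaborates with this file. -/

@[closes "route-PneNP-SzkEntropy"] theorem closes (hX : PeaThreeNotInP) (hPH : PeaMemPH) (hC : PhCollapse) (hB : CookModelBridge) : _root_.PneNP := by
  by_contra hne
  refine hX (Literature.Computability.Complexity.promiseLift_mono (hC ?_) (hPH 3))
  intro L hL
  by_contra hLP
  exact hne ⟨L, hB.2 ▸ hL, fun h => hLP (hB.1 ▸ h)⟩

end Summit.PneNP.PneNP.Theses.SzkEntropy
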